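import Literature.MathematicalPhysics.QuantumFieldTheory.Balaban1983to89.T4HistoryLipschitzActivity
import Literature.MathematicalPhysics.QuantumFieldTheory.PolymerCombinatorics

/-!
# T4HistoryLipschitzEntropy (v1.2) — the KP inequality of the activity binder FROM exponential decay in the support size and
the Peierls–Kotecký–Preiss entropy bound

Trunk: ConstructiveQFT / Bałaban 1983–89, T⁴ output-rate estimate NE9 (coupling-history Lipschitz continuity with fading
memory, `T4OutputRate.NE9`), lineage NE9-P2 (inductive route).  Rung (B)+1 on a FIXED FINITE T⁴ — not infinite volume, not a
mass gap, not the Clay problem.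

WHAT THIS LEAF DOES.  The sibling leaf `T4HistoryLipschitzActivity` reduces NE9 ∧ FadingMemory to the activity binder
POTENTIAL-KP(G), whose only analytic clause left displayed after its §7–§8 is the KOTECKÝ–PREISS INEQUALITY for the
configuration-free majorant `m` in every step volume,
`∀ γ ∈ vol X, ∑_{γ' ∈ vol X, γ' ι γ} m(γ')·e^{a(γ') + d(γ')} ≤ a(γ)` (hypothesis `hkp` of `potentialKP[G]_of_avgExpLinear`;
GAPS G-ne9p2-5 (i)).  Here that clause is DERIVED (kernel) from two inputs of printed TYPE:
* DECAY IN THE SUPPORT SIZE: every polymer `γ'` of the volume has a finite support `supp γ' ⊆ Λ` in a site set with a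
  symmetric adjacency of degree `≤ D`, supports of polymers of one volume are nonempty, connected and pairwise distinct,
  incompatible polymers have TOUCHING supports (a common site, or a site of one adjacent to a site of the other — the
  incompatibility of [II] (2.11) p.14 «ζ(Z, Z′) = 0 if Z ∩ Z′ contains a cube, or a wall of a cube, and ζ(Z, Z′) = 1
  otherwise» under sites ↦ big cubes, `adj` ⊇ wall adjacency), and `0 ≤ m(γ') ≤ ε·y^{|supp γ'|}` — decay in the NUMBER OF
  CUBES: the TYPE of the activity bound of [II] Lemma 3 p.20, (2.38) `|H(Z)| ≤ C₃ε₁ exp(−(1 − 8δ)½Lκd_{k+1}(Z))` for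
  `Z ∈ 𝐃_{k+1}` (schematic transcription, not a quotation), once the tree length `d_{k+1}(Z)` is bounded below by an affine
  function of the number of cubes of `Z` (cf. the printed two-sided comparability (2.30) p.18
  «(3·2³)⁻¹M⁻⁴|Y| ≤ d_k(Y) ≤ M⁻⁴|Y| − 1», «holding for localization domains Y ∈ 𝐃_k») — a READING: the constants are
  absorbed in `ε`, `y`, and the bound is NOT PRINTED uniformly over the tables of previous terms;
* the ENTROPY BOUND `∑_{X ∋ x connected, X ⊆ Λ} z^{|X|} ≤ θ` for `z·e^{Dθ} ≤ θ` — PROVED in the tree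
  (`Polymer.sum_isConn_pow_card_le`, Friedli–Velenik 2017 Lemma 3.38 / (5.27); it is the counting behind [II] (2.40)–(2.41)
  p.21 and Kotecký–Preiss 1986 (1)–(3));
with the weights `a(γ) = a₁·|supp γ|`, `d(γ) = d₁·|supp γ|` and the two smallness conditions
`y·e^{a₁ + d₁}·e^{Dθ} ≤ θ` (entropy) and `ε·θ·(D + 1) ≤ a₁` (Kotecký–Preiss; `D + 1` = the size of a closed neighbourhood
of a site).  Proof: union bound over the closed neighbourhoods of the sites of `supp γ`, then the entropy bound at each
site (§1 `kp_of_decay_touch`; the overlap form `kp_of_decay`, smallness `ε·θ ≤ a₁`, is kept); §2 lifts it to the `hkp`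
clause of a `ClusterGeom` through a support map (`Supported`, `Supported.kpClause_of_decay`) and §3 composes with
`potentialKPG_of_avgExpLinear`
(`Supported.potentialKPG_of_avgExpLinear_decay`); §4 is a non-vacuity toy; §5 derives the sibling leaf's remaining
geometric binders `DecayExtract` / `PinBudget` from a COVER condition, a PIN-SIZE bound and the comparability
`κ·d(X) ≤ d₁·n X` (`decayExtract_of_cover`, `pinBudget_of_pinSize`); §6 (v1.1, APPEND-ONLY; §1–§5 byte-identical to v1)
specialises §3 to the EVALUATION-TYPE functionals of the sibling leaf §8e (`Supported.potentialKPG_of_avgEvalExpLinear_decay`),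
discharging the scalar measurability and the norm bound of the functionals by construction.  NOT PRINTED and therefore still DISPLAYED: the decay bound for the
configuration-free majorant `∫ ‖pre‖·e^{l R₀} dμ` UNIFORMLY over tables of size `< R₀` (GAPS G-ne9p2-5 (i), now in decay
form), and the geometric side conditions of the support map for the concrete T⁴ geometry (READING of [II] (2.11)–(2.13);
the sibling leaf `T4HistoryLipschitzCubeGeometry` is to discharge them for finite cube families).

VERSIONS.  v1 (p187734): §1–§5.  v1.1 (p187967): + §6, append-only.  v1.2 (THIS FILE) is a RETYPE, NOT append-only,
answering the cross-read XREAD C-ne4p1-20 (t4-ne4-p1-g9, 2026-08-19) objection O1: the v1/v1.1 field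
`Supported.overlap : inc γ' γ → ¬ Disjoint (supp γ') (supp γ)` MISREAD (2.11) p.14 — two localization domains sharing only
a WALL are incompatible there but have DISJOINT sets of cubes, so the field was unsatisfiable for the intended T⁴ instance
(kernel witness of the reader: `XreadEntropyOverlap.overlap_reading_fails`).  Changes: field `overlap` ↦ `touch`
(`inc γ' γ → ∃ x ∈ supp γ, ∃ x' ∈ supp γ', x' = x ∨ adj x x'`); new §1 lemma `kp_of_decay_touch` (the reader's repair
template, same proof with the site sum over closed neighbourhoods) and `touch_of_overlap`; the smallness `ε k·θ ≤ a₁`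
becomes `ε k·θ·(D + 1) ≤ a₁` in `kpClause_of_decay`, `potentialKPG_of_avgExpLinear_decay`, `toy_kpClause`,
`potentialKPG_of_avgEvalExpLinear_decay` (signature changes — announced; no module outside this lineage imports the leaf);
DOCFIX D1 (the v1 header's guillemeted schematic `|E^{(k)}(X)| ≤ O(1) exp(−κ d_k(X))` was not a quotation: replaced by the
schematic transcription of (2.38) p.20 above) and D2 ((2.30) p.18 named as the PRINTED comparability of `d_k` with the
number of cubes, §5 docstrings).  `kp_of_decay`, `decayExtract_of_cover`, `pinBudget_of_pinSize` unchanged.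

ABSOLUTE RULE respected: no internally-minted statement is cited as a fact; the manuscript under audit ([II] =
Bałaban, CMP 116 (1988) 1–22) is quoted for TYPES of hypotheses only, by page; everything else is kernel-proved here or in
the imported tree files.

References: [Balaban1988RG2Cluster] T. Bałaban, Renormalization group approach to lattice gauge field theories. II,
CMP 116 (1988), (2.11)–(2.13) p.14, (2.26) p.17, (2.30) p.18, Lemma 3 (2.38) p.20, (2.39)–(2.41) p.21; [KoteckyPreiss1986] R. Kotecký, D. Preiss, CMP 103 (1986) 491–498,
(1)–(3); [FriedliVelenik2017] Lemma 3.38, (5.27).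
-/

noncomputable section

namespace Literature.MathematicalPhysics.QuantumFieldTheory.Balaban1983to89.T4HistoryLipschitzEntropy

open scoped BigOperators
open Metric Set MeasureTheory
open Literature.MathematicalPhysics.QuantumFieldTheory.Balaban1983to89.T4OutputRate
open Literature.MathematicalPhysics.QuantumFieldTheory.Balaban1983to89.T4ActivityLipschitz
open Literature.MathematicalPhysics.QuantumFieldTheory.Balaban1983to89.T4HistoryLipschitzRecursion
open Literature.MathematicalPhysics.QuantumFieldTheory.Balaban1983to89.T4HistoryLipschitzActivity

/-! ## §1 The abstract inequality: KP from decay in the support size + entropy -/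

section Abstract

variable {α : Type*} {adj : α → α → Prop}

/-- A rooted connected set is connected when rooted at any of its points. [folklore] -/
theorem isConn_reroot [Std.Symm adj] {X : Finset α} {a b : α} (h : Polymer.IsConn adj X a) (hb : b ∈ X) :
    Polymer.IsConn adj X b :=
  ⟨hb, fun c hc => (h.2 b hb).symm.trans (h.2 c hc)⟩

variable [DecidableEq α] [DecidableRel adj] [Std.Symm adj]

/-- **Entropy bound with a prefactor**: `∑_{X ∋ x connected, X ⊆ Λ} ε·z^{|X|} ≤ ε·θ` for `0 ≤ ε`, `0 ≤ z`, `z·e^{Dθ} ≤ θ`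
(∘ `Polymer.sum_isConn_pow_card_le`). [cite: FriedliVelenik2017, Lemma 3.38 and (5.27)] -/
theorem sum_isConn_mul_pow_card_le [∀ (X : Finset α) (a : α), Decidable (Polymer.IsConn adj X a)]
    (D : ℕ) (hD : ∀ (a : α) (P : Finset α), (P.filter (adj a)).card ≤ D) {ε z θ : ℝ} (hε : 0 ≤ ε) (hz : 0 ≤ z)
    (hθ : z * Real.exp (D * θ) ≤ θ) (Λ : Finset α) (x : α) :
    ∑ X ∈ Λ.powerset.filter (fun X => Polymer.IsConn adj X x), ε * z ^ X.card ≤ ε * θ := by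
  rw [← Finset.mul_sum]
  exact mul_le_mul_of_nonneg_left (Polymer.sum_isConn_pow_card_le (adj := adj) D hD hz hθ Λ x) hε

/-- **KOTECKÝ–PREISS FROM DECAY AND ENTROPY (abstract form).**  Polymers `γ' ∈ L` with pairwise distinct, nonempty,
connected supports `supp γ' ⊆ Λ` in a site set of adjacency-degree `≤ D`; an incompatibility implying overlap of supports;
a nonnegative majorant with `m(γ') ≤ ε·y^{|supp γ'|}` on `L`; weights `a₁·|supp|`, `d₁·|supp|`; smallness `y·e^{a₁+d₁}·e^{Dθ} ≤ θ` and
`ε·θ ≤ a₁`.  Then `∑_{γ' ∈ L, γ' ι γ} m(γ')·e^{a₁|supp γ'| + d₁|supp γ'|} ≤ a₁·|supp γ|`.  Proof: union bound over the sites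
of `supp γ` and the entropy bound at each site. [cite: KoteckyPreiss1986, (1)-(3); FriedliVelenik2017, Lemma 3.38] -/
theorem kp_of_decay {P : Type*} {inc : P → P → Prop} [DecidableRel inc] (D : ℕ) (hD : ∀ (a : α) (Q : Finset α), (Q.filter (adj a)).card ≤ D)
    {L : Finset P} {supp : P → Finset α} {Λ : Finset α} (hsub : ∀ γ' ∈ L, supp γ' ⊆ Λ)
    (hconn : ∀ γ' ∈ L, ∃ a ∈ supp γ', Polymer.IsConn adj (supp γ') a) (hinj : Set.InjOn supp L)
    (hinc : ∀ γ' ∈ L, ∀ γ, inc γ' γ → ¬ Disjoint (supp γ') (supp γ))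
    {m : P → ℝ} {ε y a₁ d₁ θ : ℝ} (hε : 0 ≤ ε) (hy : 0 ≤ y) (hm0 : ∀ γ', 0 ≤ m γ')
    (hm : ∀ γ' ∈ L, m γ' ≤ ε * y ^ (supp γ').card) (hθ : y * Real.exp (a₁ + d₁) * Real.exp (D * θ) ≤ θ)
    (hεθ : ε * θ ≤ a₁) (γ : P) :
    ∑ γ' ∈ L with inc γ' γ, m γ' * Real.exp (a₁ * (supp γ').card + d₁ * (supp γ').card) ≤ a₁ * (supp γ).card := by
  classical
  set z : ℝ := y * Real.exp (a₁ + d₁) with hz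
  have hz0 : 0 ≤ z := mul_nonneg hy (Real.exp_nonneg _)
  -- each term is bounded by `ε z^{|supp γ'|}` and is nonnegative
  have hterm : ∀ γ' ∈ L, m γ' * Real.exp (a₁ * (supp γ').card + d₁ * (supp γ').card) ≤ ε * z ^ (supp γ').card := by
    intro γ' hγ'
    have hexp : Real.exp (a₁ * (supp γ').card + d₁ * (supp γ').card) = Real.exp (a₁ + d₁) ^ (supp γ').card := by
      rw [← Real.exp_nat_mul]; congr 1; ring
    rw [hexp, hz, mul_pow, ← mul_assoc]
    exact mul_le_mul_of_nonneg_right (hm γ' hγ') (pow_nonneg (Real.exp_nonneg _) _)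
  have hnn : ∀ γ', 0 ≤ m γ' * Real.exp (a₁ * (supp γ').card + d₁ * (supp γ').card) :=
    fun γ' => mul_nonneg (hm0 γ') (Real.exp_nonneg _)
  -- union bound over the sites of `supp γ`
  have hcover : L.filter (fun γ' => inc γ' γ) ⊆ (supp γ).biUnion fun x => L.filter fun γ' => x ∈ supp γ' := by
    intro γ' hγ'
    obtain ⟨hL, hi⟩ := Finset.mem_filter.1 hγ'
    obtain ⟨x, hx', hx⟩ := Finset.not_disjoint_iff.1 (hinc γ' hL γ hi)
    exact Finset.mem_biUnion.2 ⟨x, hx, Finset.mem_filter.2 ⟨hL, hx'⟩⟩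
  -- at each site: the polymers of `L` through `x` inject into the connected subsets of `Λ` rooted at `x`
  have hsite : ∀ x, ∑ γ' ∈ L.filter (fun γ' => x ∈ supp γ'),
      m γ' * Real.exp (a₁ * (supp γ').card + d₁ * (supp γ').card) ≤ ε * θ := by
    intro x
    calc ∑ γ' ∈ L.filter (fun γ' => x ∈ supp γ'), m γ' * Real.exp (a₁ * (supp γ').card + d₁ * (supp γ').card)
        ≤ ∑ γ' ∈ L.filter (fun γ' => x ∈ supp γ'), ε * z ^ (supp γ').card :=
          Finset.sum_le_sum fun γ' hγ' => hterm γ' (Finset.mem_filter.1 hγ').1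
      _ = ∑ X ∈ (L.filter (fun γ' => x ∈ supp γ')).image supp, ε * z ^ X.card := by
          rw [Finset.sum_image]
          exact fun γ₁ h₁ γ₂ h₂ he => hinj (Finset.mem_filter.1 h₁).1 (Finset.mem_filter.1 h₂).1 he
      _ ≤ ∑ X ∈ Λ.powerset.filter (fun X => Polymer.IsConn adj X x), ε * z ^ X.card := by
          refine Finset.sum_le_sum_of_subset_of_nonneg ?_ fun X _ _ => mul_nonneg hε (pow_nonneg hz0 _)
          intro X hX
          obtain ⟨γ', hγ', rfl⟩ := Finset.mem_image.1 hX
          obtain ⟨hL, hxγ'⟩ := Finset.mem_filter.1 hγ'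
          obtain ⟨a, _, hca⟩ := hconn γ' hL
          exact Finset.mem_filter.2 ⟨Finset.mem_powerset.2 (hsub γ' hL), isConn_reroot hca hxγ'⟩
      _ ≤ ε * θ := sum_isConn_mul_pow_card_le D hD hε hz0 hθ Λ x
  calc ∑ γ' ∈ L with inc γ' γ, m γ' * Real.exp (a₁ * (supp γ').card + d₁ * (supp γ').card)
      ≤ ∑ γ' ∈ (supp γ).biUnion (fun x => L.filter fun γ' => x ∈ supp γ'),
          m γ' * Real.exp (a₁ * (supp γ').card + d₁ * (supp γ').card) :=
        Finset.sum_le_sum_of_subset_of_nonneg hcover fun γ' _ _ => hnn γ'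
    _ ≤ ∑ x ∈ supp γ, ∑ γ' ∈ L.filter (fun γ' => x ∈ supp γ'),
          m γ' * Real.exp (a₁ * (supp γ').card + d₁ * (supp γ').card) :=
        Polymer.sum_biUnion_le_sum (supp γ) (fun x => L.filter fun γ' => x ∈ supp γ')
          (fun γ' => m γ' * Real.exp (a₁ * (supp γ').card + d₁ * (supp γ').card)) hnn
    _ ≤ ∑ x ∈ supp γ, ε * θ := Finset.sum_le_sum fun x _ => hsite x
    _ = ε * θ * (supp γ).card := by rw [Finset.sum_const, nsmul_eq_mul, mul_comm]
    _ ≤ a₁ * (supp γ).card := mul_le_mul_of_nonneg_right hεθ (Nat.cast_nonneg _)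

/-- **KOTECKÝ–PREISS FROM DECAY AND ENTROPY — TOUCH FORM (abstract; v1.2).**  As `kp_of_decay`, with the incompatibility
allowed to mean "a common site OR a site adjacent to a site" (gloss) — the printed ζ of [II] (2.11) p.14 («ζ(Z, Z′) = 0 if Z ∩ Z′
contains a cube, or a wall of a cube») under sites ↦ big cubes, `adj` ⊇ wall adjacency; the price is the factor `D + 1`
(a closed neighbourhood of a site) in the smallness `ε·θ·(D + 1) ≤ a₁`.  Proof: union bound over the closed neighbourhoods
of the sites of `supp γ`, entropy bound at each site.  (Repair template of the cross-read C-ne4p1-20, t4-ne4-p1-g9.)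
[cite: KoteckyPreiss1986, (1)-(3); FriedliVelenik2017, Lemma 3.38] -/
theorem kp_of_decay_touch {P : Type*} {inc : P → P → Prop} [DecidableRel inc] (D : ℕ)
    (hD : ∀ (a : α) (Q : Finset α), (Q.filter (adj a)).card ≤ D)
    {L : Finset P} {supp : P → Finset α} {Λ : Finset α} (hsub : ∀ γ' ∈ L, supp γ' ⊆ Λ)
    (hconn : ∀ γ' ∈ L, ∃ a ∈ supp γ', Polymer.IsConn adj (supp γ') a) (hinj : Set.InjOn supp L)
    (htouch : ∀ γ' ∈ L, ∀ γ, inc γ' γ → ∃ x ∈ supp γ, ∃ x' ∈ supp γ', x' = x ∨ adj x x')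
    {m : P → ℝ} {ε y a₁ d₁ θ : ℝ} (hε : 0 ≤ ε) (hy : 0 ≤ y) (hm0 : ∀ γ', 0 ≤ m γ')
    (hm : ∀ γ' ∈ L, m γ' ≤ ε * y ^ (supp γ').card) (hθ : y * Real.exp (a₁ + d₁) * Real.exp (D * θ) ≤ θ)
    (hεθ : ε * θ * ((D : ℝ) + 1) ≤ a₁) (γ : P) :
    ∑ γ' ∈ L with inc γ' γ, m γ' * Real.exp (a₁ * (supp γ').card + d₁ * (supp γ').card) ≤ a₁ * (supp γ).card := by
  classical
  have hθ0 : 0 ≤ θ := le_trans (by positivity) hθ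
  set f : P → ℝ := fun γ' => m γ' * Real.exp (a₁ * (supp γ').card + d₁ * (supp γ').card) with hf
  have hnn : ∀ γ', 0 ≤ f γ' := fun γ' => mul_nonneg (hm0 γ') (Real.exp_nonneg _)
  set z : ℝ := y * Real.exp (a₁ + d₁) with hz
  have hz0 : 0 ≤ z := by positivity
  have hterm : ∀ γ' ∈ L, f γ' ≤ ε * z ^ (supp γ').card := by
    intro γ' hγ'
    have hexp : Real.exp (a₁ * (supp γ').card + d₁ * (supp γ').card) = Real.exp (a₁ + d₁) ^ (supp γ').card := by
      rw [← Real.exp_nat_mul]; congr 1; ring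
    show m γ' * Real.exp (a₁ * (supp γ').card + d₁ * (supp γ').card) ≤ _
    rw [hexp, hz, mul_pow, ← mul_assoc]
    exact mul_le_mul_of_nonneg_right (hm γ' hγ') (pow_nonneg (Real.exp_nonneg _) _)
  -- at each site: the polymers of `L` through `x'` inject into the connected subsets of `Λ` rooted at `x'`
  have hsite : ∀ x, ∑ γ' ∈ L.filter (fun γ' => x ∈ supp γ'), f γ' ≤ ε * θ := by
    intro x
    calc ∑ γ' ∈ L.filter (fun γ' => x ∈ supp γ'), f γ'
        ≤ ∑ γ' ∈ L.filter (fun γ' => x ∈ supp γ'), ε * z ^ (supp γ').card :=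
          Finset.sum_le_sum fun γ' hγ' => hterm γ' (Finset.mem_filter.1 hγ').1
      _ = ∑ X ∈ (L.filter (fun γ' => x ∈ supp γ')).image supp, ε * z ^ X.card := by
          rw [Finset.sum_image]
          exact fun γ₁ h₁ γ₂ h₂ he => hinj (Finset.mem_filter.1 h₁).1 (Finset.mem_filter.1 h₂).1 he
      _ ≤ ∑ X ∈ Λ.powerset.filter (fun X => Polymer.IsConn adj X x), ε * z ^ X.card := by
          refine Finset.sum_le_sum_of_subset_of_nonneg ?_ fun X _ _ => mul_nonneg hε (pow_nonneg hz0 _)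
          intro X hX
          obtain ⟨γ', hγ', rfl⟩ := Finset.mem_image.1 hX
          obtain ⟨hL, hxγ'⟩ := Finset.mem_filter.1 hγ'
          obtain ⟨a, _, hca⟩ := hconn γ' hL
          exact Finset.mem_filter.2 ⟨Finset.mem_powerset.2 (hsub γ' hL), isConn_reroot hca hxγ'⟩
      _ ≤ ε * θ := sum_isConn_mul_pow_card_le D hD hε hz0 hθ Λ x
  -- closed neighbourhoods of the sites of `supp γ`
  set nb : α → Finset α := fun x => insert x (Λ.filter (adj x)) with hnb
  have hnb_card : ∀ x, ((nb x).card : ℝ) ≤ D + 1 := by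
    intro x
    have h1 : (nb x).card ≤ (Λ.filter (adj x)).card + 1 := Finset.card_insert_le _ _
    have h2 := hD x Λ
    exact_mod_cast h1.trans (by omega)
  have hcover : L.filter (fun γ' => inc γ' γ) ⊆
      (supp γ).biUnion fun x => (nb x).biUnion fun x' => L.filter fun γ' => x' ∈ supp γ' := by
    intro γ' hγ'
    obtain ⟨hL, hi⟩ := Finset.mem_filter.1 hγ'
    obtain ⟨x, hx, x', hx', hxx'⟩ := htouch γ' hL γ hi
    refine Finset.mem_biUnion.2 ⟨x, hx, Finset.mem_biUnion.2 ⟨x', ?_, Finset.mem_filter.2 ⟨hL, hx'⟩⟩⟩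
    rcases hxx' with rfl | hadj
    · exact Finset.mem_insert_self _ _
    · exact Finset.mem_insert_of_mem (Finset.mem_filter.2 ⟨hsub γ' hL hx', hadj⟩)
  have hεθ0 : 0 ≤ ε * θ := mul_nonneg hε hθ0
  calc ∑ γ' ∈ L with inc γ' γ, f γ'
      ≤ ∑ γ' ∈ (supp γ).biUnion (fun x => (nb x).biUnion fun x' => L.filter fun γ' => x' ∈ supp γ'), f γ' :=
        Finset.sum_le_sum_of_subset_of_nonneg hcover fun γ' _ _ => hnn γ'
    _ ≤ ∑ x ∈ supp γ, ∑ γ' ∈ (nb x).biUnion (fun x' => L.filter fun γ' => x' ∈ supp γ'), f γ' :=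
        Polymer.sum_biUnion_le_sum (supp γ) _ f hnn
    _ ≤ ∑ x ∈ supp γ, ∑ x' ∈ nb x, ∑ γ' ∈ L.filter (fun γ' => x' ∈ supp γ'), f γ' :=
        Finset.sum_le_sum fun x _ => Polymer.sum_biUnion_le_sum (nb x) _ f hnn
    _ ≤ ∑ x ∈ supp γ, ∑ x' ∈ nb x, ε * θ :=
        Finset.sum_le_sum fun x _ => Finset.sum_le_sum fun x' _ => hsite x'
    _ = ∑ x ∈ supp γ, ((nb x).card : ℝ) * (ε * θ) := by
        refine Finset.sum_congr rfl fun x _ => ?_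
        rw [Finset.sum_const, nsmul_eq_mul]
    _ ≤ ∑ x ∈ supp γ, ((D : ℝ) + 1) * (ε * θ) :=
        Finset.sum_le_sum fun x _ => mul_le_mul_of_nonneg_right (hnb_card x) hεθ0
    _ = ε * θ * ((D : ℝ) + 1) * (supp γ).card := by
        rw [Finset.sum_const, nsmul_eq_mul]; ring
    _ ≤ a₁ * (supp γ).card := mul_le_mul_of_nonneg_right hεθ (Nat.cast_nonneg _)

omit [DecidableEq α] [DecidableRel adj] [Std.Symm adj] in
/-- The touch clause is WEAKER than the overlap clause of `kp_of_decay` (so `kp_of_decay_touch` also covers that setting, at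
the cost of the factor `D + 1`). [folklore] -/
theorem touch_of_overlap {P : Type*} {inc : P → P → Prop} {L : Finset P} {supp : P → Finset α}
    (hinc : ∀ γ' ∈ L, ∀ γ, inc γ' γ → ¬ Disjoint (supp γ') (supp γ)) :
    ∀ γ' ∈ L, ∀ γ, inc γ' γ → ∃ x ∈ supp γ, ∃ x' ∈ supp γ', x' = x ∨ adj x x' := by
  intro γ' hγ' γ hi
  obtain ⟨x, hx', hx⟩ := Finset.not_disjoint_iff.1 (hinc γ' hγ' γ hi)
  exact ⟨x, hx, x, hx', Or.inl rfl⟩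

end Abstract

/-! ## §2 Lift to a cluster geometry through a SUPPORT MAP -/

open Literature.MathematicalPhysics.QuantumFieldTheory.Balaban1983to89.T4HistoryLipschitzActivity (ClusterGeom)

/-- **SUPPORT MAP (HYPOTHESIS SHAPE; v1.2 field `touch`)** for a cluster geometry `G`: every polymer has a finite SUPPORT
in a site type `α` carrying an adjacency `adj` of degree `≤ D`; in each step volume the supports lie in a finite REGION,
are nonempty and connected, distinct polymers of one volume have distinct supports, and a polymer of the volume
incompatible with `γ` has a site equal OR ADJACENT to a site of `γ` (TOUCH).  READING of [II] (2.11)–(2.13) p.14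
(localization domains are connected unions of big cubes of the current lattice, [I] p.257; «ζ(Z, Z′) = 0 if Z ∩ Z′
contains a cube, or a wall of a cube, and ζ(Z, Z′) = 1 otherwise»), with sites ↦ big cubes and `adj` ⊇ wall adjacency; the
sibling leaf `T4HistoryLipschitzCubeGeometry` constructs it for finite cube families. [cite: Balaban1988RG2Cluster, (2.11)-(2.13) p.14] -/
structure Supported {C : Carriers} (G : ClusterGeom C) (α : Type*) [DecidableEq α] (adj : α → α → Prop)
    [DecidableRel adj] (D : ℕ) where
  /-- the support of a polymer -/
  supp : G.P → Finset α
  /-- the region of the step of `X` -/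
  region : C.Dom → Finset α
  deg : ∀ (a : α) (Q : Finset α), (Q.filter (adj a)).card ≤ D
  sub : ∀ X, ∀ γ ∈ G.vol X, supp γ ⊆ region X
  conn : ∀ X, ∀ γ ∈ G.vol X, ∃ a ∈ supp γ, Polymer.IsConn adj (supp γ) a
  inj : ∀ X, Set.InjOn supp (G.vol X : Set G.P)
  touch : ∀ X, ∀ γ' ∈ G.vol X, ∀ γ, G.inc γ' γ → ∃ x ∈ supp γ, ∃ x' ∈ supp γ', x' = x ∨ adj x x'

namespace Supported

variable {C : Carriers} {G : ClusterGeom C} {Bg : Type} {α : Type*} [DecidableEq α] {adj : α → α → Prop}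
  [DecidableRel adj] [Std.Symm adj] {D : ℕ}

/-- size weights `a(γ) = a₁·|supp γ|`. [folklore] -/
def sizeWeight (S : Supported G α adj D) (a₁ : ℝ) : G.P → ℝ := fun γ => a₁ * ((S.supp γ).card : ℝ)

omit [Std.Symm adj] in
/-- size weights with a nonnegative constant are nonnegative. [folklore] -/
theorem sizeWeight_nonneg (S : Supported G α adj D) {a₁ : ℝ} (h : 0 ≤ a₁) (γ : G.P) : 0 ≤ S.sizeWeight a₁ γ :=
  mul_nonneg h (Nat.cast_nonneg _)

/-- **THE `hkp` CLAUSE FROM DECAY (kernel; v1.2: touch form, factor `D + 1`).**  Under a support map, a nonnegative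
majorant `M` with `M k (g k) U γ' ≤ ε k · y^{|supp γ'|}` on every step volume at the occurring couplings, and the
smallness conditions `y·e^{a₁+d₁}·e^{Dθ} ≤ θ`, `ε k·θ·(D + 1) ≤ a₁`, give the Kotecký–Preiss clause of POTENTIAL-KP(G)
with the size weights `a₁·|supp|`, `d₁·|supp|` (∘ `kp_of_decay_touch`). [cite: KoteckyPreiss1986, (1)-(3); Balaban1988RG2Cluster, Lemma 3 (2.38) p.20 and (2.39)-(2.41) p.21] -/
theorem kpClause_of_decay (S : Supported G α adj D) {W : Set (ℕ → ℝ)} {M : ℕ → ℝ → Bg → G.P → ℝ} {ε : ℕ → ℝ}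
    {y a₁ d₁ θ : ℝ} (hε : ∀ k, 0 ≤ ε k) (hy : 0 ≤ y) (hM0 : ∀ k s U γ', 0 ≤ M k s U γ')
    (hdec : ∀ g ∈ W, ∀ (k : ℕ) (U : Bg) (X : C.Dom), C.scale X = k + 1 → ∀ γ' ∈ G.vol X,
      M k (g k) U γ' ≤ ε k * y ^ (S.supp γ').card)
    (hθ : y * Real.exp (a₁ + d₁) * Real.exp (D * θ) ≤ θ) (hεθ : ∀ k, ε k * θ * ((D : ℝ) + 1) ≤ a₁) :
    ∀ g ∈ W, ∀ (k : ℕ) (U : Bg) (X : C.Dom), C.scale X = k + 1 → ∀ γ ∈ G.vol X,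
      ∑ γ' ∈ G.vol X with G.inc γ' γ, M k (g k) U γ' * Real.exp (S.sizeWeight a₁ γ' + S.sizeWeight d₁ γ') ≤
        S.sizeWeight a₁ γ := by
  classical
  intro g hg k U X hX γ _
  exact kp_of_decay_touch (adj := adj) (inc := G.inc) D S.deg (S.sub X) (S.conn X) (S.inj X) (S.touch X) (hε k) hy
    (hM0 k (g k) U) (hdec g hg k U X hX) hθ (hεθ k) γ

end Supported

/-! ## §3 Composition with the averaged exp-linear activities of the sibling leaf -/

namespace Supported

variable {C : Carriers} {G : ClusterGeom C} {Bg : Type} {α : Type*} [DecidableEq α] {adj : α → α → Prop}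
  [DecidableRel adj] [Std.Symm adj] {D : ℕ}
variable {Pot : Type*} [NormedAddCommGroup Pot] [NormedSpace ℂ Pot] {Ω : Type*} [MeasurableSpace Ω]

omit [Std.Symm adj] in
/-- the configuration-free majorant of the sibling leaf is nonnegative. [folklore] -/
theorem avgExpLinearMajorant_nonneg (μ : ℕ → ℝ → Bg → G.P → Measure Ω) (pre : ℕ → ℝ → Bg → G.P → Ω → ℂ)
    (l : ℕ → ℝ → Bg → G.P → ℝ) (R₀ : ℝ) (k : ℕ) (s : ℝ) (U : Bg) (γ : G.P) :
    0 ≤ G.avgExpLinearMajorant μ pre l R₀ k s U γ :=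
  integral_nonneg fun _ => mul_nonneg (norm_nonneg _) (Real.exp_pos _).le

/-- **POTENTIAL-KPG FROM DECAY OF THE CONFIGURATION-FREE MAJORANT (kernel end-to-end).**  For the averaged exp-linear
activities of `T4HistoryLipschitzActivity` §7–§8 (integrable prefactors, scalarly measurable functionals of norm `≤ l`,
`0 ≤ R₀`) on a cluster geometry with a support map: if the configuration-free majorant `∫ ‖pre‖·e^{l R₀} dμ` DECAYS in
the support size, `≤ ε k · y^{|supp γ'|}` on every step volume at the occurring couplings, and `y·e^{a₁+d₁}·e^{Dθ} ≤ θ`,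
`ε k·θ·(D + 1) ≤ a₁`, `0 ≤ a₁, d₁`, then POTENTIAL-KPG holds with the size weights — and hence (sibling leaf §8c) OutputLipschitz and
NE9 ∧ FadingMemory, given the remaining displayed binders there.  DISPLAYED here: the decay bound (GAPS G-ne9p2-5 (i) in
decay form — [II] (2.26)/(2.37) print it for ONE table with `E₀`; uniformity over tables of size `< R₀` is NOT PRINTED) and
the support map. [cite: Balaban1988RG2Cluster, (2.26) p.17, (2.37)-(2.41) pp.20-21; KoteckyPreiss1986, (1)-(3)] -/
theorem potentialKPG_of_avgExpLinear_decay (S : Supported G α adj D) {W : Set (ℕ → ℝ)}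
    {μ : ℕ → ℝ → Bg → G.P → Measure Ω} {pre : ℕ → ℝ → Bg → G.P → Ω → ℂ}
    {lin : ℕ → ℝ → Bg → G.P → Ω → (Pot →L[ℂ] ℂ)} {l : ℕ → ℝ → Bg → G.P → ℝ} {R₀ : ℝ} {ε : ℕ → ℝ} {y a₁ d₁ θ : ℝ}
    (ha₁ : 0 ≤ a₁) (hd₁ : 0 ≤ d₁) (hR : 0 ≤ R₀) (hpre : ∀ k s U γ, Integrable (pre k s U γ) (μ k s U γ))
    (hlinw : ∀ k s U γ (Q : Pot), AEStronglyMeasurable (fun ω => lin k s U γ ω Q) (μ k s U γ))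
    (hl : ∀ k s U γ ω, ‖lin k s U γ ω‖ ≤ l k s U γ) (hε : ∀ k, 0 ≤ ε k) (hy : 0 ≤ y)
    (hdec : ∀ g ∈ W, ∀ (k : ℕ) (U : Bg) (X : C.Dom), C.scale X = k + 1 → ∀ γ' ∈ G.vol X,
      G.avgExpLinearMajorant μ pre l R₀ k (g k) U γ' ≤ ε k * y ^ (S.supp γ').card)
    (hθ : y * Real.exp (a₁ + d₁) * Real.exp (D * θ) ≤ θ) (hεθ : ∀ k, ε k * θ * ((D : ℝ) + 1) ≤ a₁) :
    G.PotentialKPG W (G.avgExpLinearAct μ pre lin) (G.avgExpLinearMajorant μ pre l R₀) (S.sizeWeight a₁)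
      (S.sizeWeight d₁) R₀ :=
  G.potentialKPG_of_avgExpLinear (S.sizeWeight_nonneg ha₁) (S.sizeWeight_nonneg hd₁) hR hpre hlinw hl
    (S.kpClause_of_decay hε hy (avgExpLinearMajorant_nonneg μ pre l R₀) hdec hθ hεθ)

end Supported

/-! ## §4 Non-vacuity: a support map for the toy geometry of the sibling leaf, and its KP clause -/

section Toy

/-- The one-site adjacency (everything adjacent). [folklore] -/
def toyAdj : Unit → Unit → Prop := fun _ _ => True

/-- the one-site adjacency is decidable. [folklore] -/
instance : DecidableRel toyAdj := fun _ _ => instDecidableTrue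

/-- the one-site adjacency is symmetric. [folklore] -/
instance : Std.Symm toyAdj := ⟨fun _ _ _ => trivial⟩

/-- The toy geometry `kpToyGeom` (one polymer, one step volume `{∙}`) carries a support map into the one-site lattice:
`supp ∙ = {∙}`, region `{∙}`, degree `≤ 1`. [folklore] -/
def toySupported : Supported kpToyGeom Unit toyAdj 1 where
  supp := fun _ => {()}
  region := fun _ => {()}
  deg := fun _ Q => (Finset.card_le_card (Finset.filter_subset _ Q)).trans (Finset.card_le_one.2 fun x _ y _ =>
    Subsingleton.elim x y)
  sub := fun _ _ _ => subset_rfl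
  conn := fun _ _ _ => ⟨(), Finset.mem_singleton_self _, Polymer.isConn_singleton (adj := toyAdj) ()⟩
  inj := fun _ _ _ _ _ _ => Subsingleton.elim _ _
  touch := fun _ _ _ _ _ => ⟨(), Finset.mem_singleton_self _, (), Finset.mem_singleton_self _, Or.inl rfl⟩

/-- Non-vacuity of §2: in the toy geometry, a nonnegative majorant bounded by `ε k·y` (one-site supports) with
`y·e^{a₁+d₁}·e^{θ} ≤ θ` and `ε k·θ·2 ≤ a₁` satisfies the KP clause with size weights (∘ `kpClause_of_decay`). [folklore] -/
theorem toy_kpClause {Bg : Type} {W : Set (ℕ → ℝ)} {M : ℕ → ℝ → Bg → Unit → ℝ} {ε : ℕ → ℝ} {y a₁ d₁ θ : ℝ}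
    (hε : ∀ k, 0 ≤ ε k) (hy : 0 ≤ y) (hM0 : ∀ k s U γ', 0 ≤ M k s U γ')
    (hdec : ∀ g ∈ W, ∀ (k : ℕ) (U : Bg) (X : ℕ), toyCarriers.scale X = k + 1 → ∀ γ' ∈ kpToyGeom.vol X,
      M k (g k) U γ' ≤ ε k * y ^ (toySupported.supp γ').card)
    (hθ : y * Real.exp (a₁ + d₁) * Real.exp ((1 : ℕ) * θ) ≤ θ) (hεθ : ∀ k, ε k * θ * (((1 : ℕ) : ℝ) + 1) ≤ a₁) :
    ∀ g ∈ W, ∀ (k : ℕ) (U : Bg) (X : ℕ), toyCarriers.scale X = k + 1 → ∀ γ ∈ kpToyGeom.vol X,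
      ∑ γ' ∈ kpToyGeom.vol X with kpToyGeom.inc γ' γ,
        M k (g k) U γ' * Real.exp (toySupported.sizeWeight a₁ γ' + toySupported.sizeWeight d₁ γ') ≤
        toySupported.sizeWeight a₁ γ :=
  toySupported.kpClause_of_decay hε hy hM0 hdec hθ hεθ

end Toy

/-! ## §5 The decay-extraction and pin-budget binders of the sibling leaf from the support map -/

namespace Supported

variable {C : Carriers} {G : ClusterGeom C} {α : Type*} [DecidableEq α] {adj : α → α → Prop} [DecidableRel adj] {D : ℕ}

/-- **`DecayExtract` FROM A COVER CONDITION (kernel).**  If every localizing family of `X` covers at least `n X` sites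
(`n X ≤ |⋃_{γ ∈ K} supp γ|` — READING of [II] (2.13) p.14 / p.21: the domains `(Z_1,…,Z_n)` of a cluster localizing at `X`
have union `X`), then the size weights `d₁·|supp|` extract the decay `d₁·n X` (`DecayExtract`). [cite: Balaban1988RG2Cluster, (2.13) p.14 and (2.40)-(2.41) p.21] -/
theorem decayExtract_of_cover (S : Supported G α adj D) {n : C.Dom → ℕ} {d₁ : ℝ} (hd₁ : 0 ≤ d₁)
    (hcover : ∀ X, ∀ K ∈ G.clus X, n X ≤ (K.biUnion S.supp).card) :
    G.DecayExtract (fun X => d₁ * (n X : ℝ)) (S.sizeWeight d₁) := by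
  intro X K hK
  have h1 : ((n X : ℕ) : ℝ) ≤ ((K.biUnion S.supp).card : ℝ) := by exact_mod_cast hcover X K hK
  have h2 : ((K.biUnion S.supp).card : ℝ) ≤ ∑ γ ∈ K, ((S.supp γ).card : ℝ) := by
    exact_mod_cast Finset.card_biUnion_le
  calc d₁ * (n X : ℝ) ≤ d₁ * ∑ γ ∈ K, ((S.supp γ).card : ℝ) := mul_le_mul_of_nonneg_left (h1.trans h2) hd₁
    _ = ∑ γ ∈ K, S.sizeWeight d₁ γ := by rw [Finset.mul_sum]; rfl

/-- **`PinBudget` FROM A PIN OF BOUNDED SUPPORT AND THE COMPARABILITY `κ·d(X) ≤ d₁·n X` (kernel).**  If the pins have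
supports of size `≤ p₀` and the carrier's decay length is dominated by the covered-site count, then the size weights
satisfy `PinBudget` with the constant envelope `B₀ = a₁·p₀`.  The comparability is the TYPE of the upper half of the
PRINTED inequality [II] (2.30) p.18 «(3·2³)⁻¹M⁻⁴|Y| ≤ d_k(Y) ≤ M⁻⁴|Y| − 1», «holding for localization domains Y ∈ 𝐃_k»
(`M⁻⁴|Y|` = the number of big cubes of `Y`; with `d₁ ≥ κ`). [cite: Balaban1988RG2Cluster, (2.30) p.18 and (2.40)-(2.41) p.21] -/
theorem pinBudget_of_pinSize (S : Supported G α adj D) {n : C.Dom → ℕ} {a₁ d₁ κ : ℝ} {p₀ : ℕ} (ha₁ : 0 ≤ a₁)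
    (hpin : ∀ X, (S.supp (G.pin X)).card ≤ p₀) (hcmp : ∀ X, κ * C.d X ≤ d₁ * (n X : ℝ)) :
    G.PinBudget (S.sizeWeight a₁) (fun X => d₁ * (n X : ℝ)) (fun _ => a₁ * (p₀ : ℝ)) κ := by
  intro k X _
  have h1 : S.sizeWeight a₁ (G.pin X) ≤ a₁ * (p₀ : ℝ) :=
    mul_le_mul_of_nonneg_left (by exact_mod_cast hpin X) ha₁
  exact mul_le_mul h1 (Real.exp_le_exp.2 (by linarith [hcmp X])) (Real.exp_pos _).le
    (mul_nonneg ha₁ (Nat.cast_nonneg _))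

end Supported

/-! ## §6 (v1.1) Evaluation-type functionals: every analytic-regularity hypothesis discharged by construction

Composition of §3 with `T4HistoryLipschitzActivity` §8e (`ClusterGeom.potentialKPG_of_avgEvalExpLinear`, v1.3): for
activities `Q ↦ ∫ pre(ω)·exp(Σ_Y c_ω(Y)·Q(pt_ω(Y))) dμ(ω)` on the table space `S →ᵇ ℂ` — integrable prefactors, measurable
coefficients and evaluation points, `Σ_Y ‖c_ω(Y)‖ ≤ l` — POTENTIAL-KPG with the size weights follows from the DECAY bound of
the configuration-free majorant alone (plus the support map and the two scalar smallness conditions).  Net list of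
displayed hypotheses of the activity binder after this theorem: (A) the decay bound `∫ ‖pre‖·e^{l R₀} dμ ≤ ε k · y^{|supp γ'|}`
(GAPS G-ne9p2-5 (i), decay form; NOT PRINTED uniformly over tables of (1.36)-size `< R₀`), (B) the support-map geometry
(`Supported`, v1.2 touch form), (C) `y·e^{a₁+d₁}·e^{Dθ} ≤ θ`, `ε k·θ·(D + 1) ≤ a₁`. -/

namespace Supported

variable {C : Carriers} {G : ClusterGeom C} {Bg : Type} {α : Type*} [DecidableEq α] {adj : α → α → Prop}
  [DecidableRel adj] [Std.Symm adj] {D : ℕ}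
variable {Sp : Type*} [TopologicalSpace Sp] [MeasurableSpace Sp] [OpensMeasurableSpace Sp] {F : Type*} [Fintype F]
  {Ω : Type*} [MeasurableSpace Ω]

/-- **POTENTIAL-KPG FROM DECAY — EVALUATION-TYPE FUNCTIONALS (kernel end-to-end; v1.1).**  §3 specialised to the
evaluation-type functionals of the sibling leaf §8e: the scalar measurability and the norm bound of the functionals are
DISCHARGED (measurable coefficients / evaluation points, `Σ_Y ‖c‖ ≤ l`), so the only displayed analytic input left is the
decay bound of the configuration-free majorant. [cite: Balaban1988RG2Cluster, (2.26) p.17, (2.37)-(2.41) pp.20-21;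
KoteckyPreiss1986, (1)-(3)] -/
theorem potentialKPG_of_avgEvalExpLinear_decay (S : Supported G α adj D) {W : Set (ℕ → ℝ)}
    {μ : ℕ → ℝ → Bg → G.P → Measure Ω} {pre : ℕ → ℝ → Bg → G.P → Ω → ℂ}
    {c : ℕ → ℝ → Bg → G.P → Ω → F → ℂ} {pt : ℕ → ℝ → Bg → G.P → Ω → F → Sp}
    {l : ℕ → ℝ → Bg → G.P → ℝ} {R₀ : ℝ} {ε : ℕ → ℝ} {y a₁ d₁ θ : ℝ}
    (ha₁ : 0 ≤ a₁) (hd₁ : 0 ≤ d₁) (hR : 0 ≤ R₀) (hpre : ∀ k s U γ, Integrable (pre k s U γ) (μ k s U γ))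
    (hc : ∀ k s U γ Y, AEStronglyMeasurable (fun ω => c k s U γ ω Y) (μ k s U γ))
    (hpt : ∀ k s U γ Y, Measurable fun ω => pt k s U γ ω Y)
    (hl : ∀ k s U γ ω, ∑ Y, ‖c k s U γ ω Y‖ ≤ l k s U γ) (hε : ∀ k, 0 ≤ ε k) (hy : 0 ≤ y)
    (hdec : ∀ g ∈ W, ∀ (k : ℕ) (U : Bg) (X : C.Dom), C.scale X = k + 1 → ∀ γ' ∈ G.vol X,
      G.avgExpLinearMajorant μ pre l R₀ k (g k) U γ' ≤ ε k * y ^ (S.supp γ').card)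
    (hθ : y * Real.exp (a₁ + d₁) * Real.exp (D * θ) ≤ θ) (hεθ : ∀ k, ε k * θ * ((D : ℝ) + 1) ≤ a₁) :
    G.PotentialKPG W (G.avgExpLinearAct μ pre (fun k s U γ ω => evalFunctional (c k s U γ ω) (pt k s U γ ω)))
      (G.avgExpLinearMajorant μ pre l R₀) (S.sizeWeight a₁) (S.sizeWeight d₁) R₀ :=
  G.potentialKPG_of_avgEvalExpLinear (S.sizeWeight_nonneg ha₁) (S.sizeWeight_nonneg hd₁) hR hpre hc hpt hl
    (S.kpClause_of_decay hε hy (avgExpLinearMajorant_nonneg μ pre l R₀) hdec hθ hεθ)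

end Supported

end Literature.MathematicalPhysics.QuantumFieldTheory.Balaban1983to89.T4HistoryLipschitzEntropy

end
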